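import Mathlib.Data.Set.Finite.Basic
import Literature.AlgebraicGeometry.Frobenioids.PerfFactorialWeak
import Literature.AlgebraicGeometry.Frobenioids.PerfFactorialPrimes
import Literature.AlgebraicGeometry.Frobenioids.PerfectionPrimes
import Literature.AlgebraicGeometry.Frobenioids.MonoidRealification
import Literature.AlgebraicGeometry.Frobenioids.Factorization
import HarnessLib

/-!
# [FrdI] Def. 2.4 (i): weakly perf-factorial = perf-factorial when factorizations are finitely supported

Mochizuki, *The geometry of Frobenioids I*, Kyushu J. Math. **62** (2008), Def. 2.4 (i), kurims p.47
[cite: MochizukiFrdI2008, Def. 2.4(i) p.47]: "(c) … `a ↦ (…, sup(Bound_{𝔭 ∪ {0}}(a)), …)` … whose image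
lies in `∏_𝔭 M^pf_𝔭`. (d) If `a ∈ M^pf_factor` and `b ∈ M^pf` satisfy `Supp(a) ⊆ Supp(b)`, then `a ∈ M^pf`."

abc-iut cell, finding F-L2d2-1 / errata register E-14 (seat abc-iut-L2-d2).  The repaired notion
`IsPerfFactorialWeak` (abc-iut-L1-t2) drops (d) for its consequences (d_ord), (d_res); `∏_ℕ ℤ≥0` separates
the two notions (`PiNatPerfFactorialWeak`).  THIS FILE shows that NOTHING IS LOST where print actually uses
perf-factoriality with finite supports ([FrdI] §6, [FrdII] — direct sums of monoprime monoids —, and the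
divisor monoids of tempered coverings with FINITE special fibre): from clauses (a)(b)(c) ALONE,
* `IsPerfFactorialWeak.factorMap_spec` — the sup calculus (each `Bound_{𝔮 ∪ {0}}(a)` is bounded and
  `M^rlf_𝔮` is `ℝ`-monoprime, so `factorMap a 𝔮` IS the supremum);
* `IsPerfFactorialWeak.factorMap_coe_pfAt` — the factorization of an element `x₀ ∈ M^pf_𝔮 ⊆ M^pf` is
  concentrated at `𝔮` with value `x₀` (a primary of class `𝔮` is divisible by no primary of another class);
* `IsPerfFactorialWeak.mem_range_of_supp_finite` — EVERY finitely supported element of `∏_𝔮 M^pf_𝔮` is a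
  factorization (induction on the support);
* `IsPerfFactorialWeak.isPerfFactorial_of_supp_finite` — hence a weakly perf-factorial monoid all of whose
  factorizations are finitely supported is perf-factorial as printed; with `IsPerfFactorial.weak` the two
  notions COINCIDE on such monoids (`isPerfFactorial_iff_weak_of_supp_finite`).
HONEST FRAMING: classical monoid algebra about a definition; nothing here bears on [IUTchIII] Cor. 3.12.
-/

namespace Literature.AlgebraicGeometry.Frobenioids

open Function

universe u

namespace IsPerfFactorialWeak

variable {M : Type u} [CommMonoid M] (h : IsPerfFactorialWeak M)
include h

/-! ### The sup calculus of clause (c) from (a), (b), (c) -/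

/-- Each `M^pf_𝔮` is monoprime (`M^pf_𝔮 ≅ (M_𝔭)^pf`, §0 p.12). [cite: MochizukiFrdI2008, Def. 2.4(i) p.47] -/
theorem isMonoprime_pfAt (𝔮 : Primes (Perfection M)) : IsMonoprime (PfAt M 𝔮) :=
  isMonoprime_submonoid_primes_perfection h.isDivisorial.isSharp h.isMonoprime 𝔮

/-- Each `M^rlf_𝔮 = M^pf_𝔮 ⊗ ℝ_{≥0}` is `ℝ`-monoprime. [cite: MochizukiFrdI2008, Def. 2.4(i) p.47] -/
theorem isRMonoprime_rlfAt (𝔮 : Primes (Perfection M)) : IsRMonoprime (RlfAt M 𝔮) :=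
  isRMonoprime_realification (h.isMonoprime_pfAt 𝔮)

/-- **`factorMap a 𝔮` is the supremum of `Bound_{𝔮 ∪ {0}}(a)`**: "bounded by `b` iff `b ≥` the
component". [cite: MochizukiFrdI2008, Def. 2.4(i) p.47] -/
theorem factorMap_spec (a : Perfection M) (𝔮 : Primes (Perfection M)) (b : RlfAt M 𝔮) :
    IsBoundedBy (boundAt M 𝔮 a) b ↔ factorMap M a 𝔮 ∣ b := by
  obtain ⟨b₀, hb₀⟩ := h.bounded 𝔮 a
  exact divSup_spec_of_isRMonoprime (h.isRMonoprime_rlfAt 𝔮) hb₀ b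

/-- An element of `Bound_{𝔮 ∪ {0}}(a)` lies below the `𝔮`-component of `a`. [cite: MochizukiFrdI2008, Def. 2.4(i) p.47] -/
theorem of_dvd_factorMap {a : Perfection M} {𝔮 : Primes (Perfection M)} (y : PfAt M 𝔮)
    (hy : y.1 ∈ 𝔮.carrier ∨ y.1 = 1) (hya : y.1 ∣ a) : Realification.of _ y ∣ factorMap M a 𝔮 :=
  (h.factorMap_spec a 𝔮 _).2 dvd_rfl _ ⟨y, hy, hya, rfl⟩

/-- A bound of `Bound_{𝔮 ∪ {0}}(a)` lies above the `𝔮`-component of `a`. [cite: MochizukiFrdI2008, Def. 2.4(i) p.47] -/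
theorem factorMap_dvd_of_isBoundedBy {a : Perfection M} {𝔮 : Primes (Perfection M)} {b : RlfAt M 𝔮}
    (hb : IsBoundedBy (boundAt M 𝔮 a) b) : factorMap M a 𝔮 ∣ b :=
  (h.factorMap_spec a 𝔮 b).1 hb

/-- If no element of `𝔮` divides `a`, the `𝔮`-component of `a` vanishes. [cite: MochizukiFrdI2008, Def. 2.4(i) p.47] -/
theorem factorMap_apply_eq_one {a : Perfection M} {𝔮 : Primes (Perfection M)}
    (hno : ∀ y : Perfection M, y ∈ 𝔮.carrier → ¬ y ∣ a) : factorMap M a 𝔮 = 1 := by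
  have hb : IsBoundedBy (boundAt M 𝔮 a) 1 := by
    rintro _ ⟨y, hy, hya, rfl⟩
    rcases hy with hy | hy
    · exact (hno y.1 hy hya).elim
    · rw [show y = 1 from Subtype.ext hy, map_one]
  exact (isSharp_realification _).1 _ (isUnit_of_dvd_one (h.factorMap_dvd_of_isBoundedBy hb))

/-! ### The factorization of an element of `M^pf_𝔮` -/

omit h in
/-- `M^pf_𝔮 = 𝔮 ∪ {0}`: an element of the submonoid `M^pf_𝔮` is trivial or a primary of class `𝔮`.
[cite: MochizukiFrdI2008, §0 p.12] -/
theorem eq_one_or_mem_carrier_of_mem_submonoid {𝔮 : Primes (Perfection M)} {x : Perfection M}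
    (hx : x ∈ 𝔮.submonoid) : x = 1 ∨ x ∈ 𝔮.carrier := by
  obtain ⟨⟨p, hp'⟩, hp⟩ := Quotient.exists_rep 𝔮
  have hpc : p ∈ 𝔮.carrier := ⟨hp', hp⟩
  exact (𝔮.mem_submonoid_iff hpc x).1 hx

/-- **The factorization of `x₀ ∈ M^pf_𝔮 ⊆ M^pf` is concentrated at `𝔮`, with value `x₀`**: a primary of
class `𝔮` is divisible by no primary of another class, and its divisors in `M^pf_𝔮` lie below it inside
`M^pf_𝔮`. [cite: MochizukiFrdI2008, Def. 2.4(i) p.47] -/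
theorem factorMap_coe_pfAt (𝔮 : Primes (Perfection M)) (x₀ : PfAt M 𝔮) :
    haveI := Classical.decEq (Primes (Perfection M));
    factorMap M (x₀ : Perfection M) = pfFactorToRlfFactor M (Pi.mulSingle 𝔮 x₀) := by
  classical
  have hsharp : IsSharp (Perfection M) := h.isDivisorial.perfection.isSharp
  have hx : (x₀ : Perfection M) = 1 ∨ (x₀ : Perfection M) ∈ 𝔮.carrier :=
    eq_one_or_mem_carrier_of_mem_submonoid x₀.2
  funext 𝔮'
  rw [pfFactorToRlfFactor_apply]
  by_cases e : 𝔮' = 𝔮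
  · rw [e, Pi.mulSingle_eq_same]
    apply Realification.dvd_antisymm
    · -- every element of `Bound_{𝔮 ∪ {0}}(x₀)` divides `x₀` inside `M^pf_𝔮`
      refine h.factorMap_dvd_of_isBoundedBy ?_
      rintro _ ⟨y, -, ⟨d, hd⟩, rfl⟩
      have hdmem : d ∈ 𝔮.submonoid := 𝔮.mem_submonoid_of_dvd ⟨y.1, by rw [hd, mul_comm]⟩ x₀.2
      exact map_dvd _ ⟨⟨d, hdmem⟩, Subtype.ext hd⟩
    · exact h.of_dvd_factorMap x₀ hx.symm dvd_rfl
  · rw [Pi.mulSingle_eq_of_ne e, map_one]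
    refine h.factorMap_apply_eq_one fun y hy hyx => ?_
    rcases hx with hx | hx
    · -- `y ∣ 1` forces `y = 1`, but `y` is primary
      rw [hx] at hyx
      exact hy.1.1 (hsharp.1 _ (isUnit_of_dvd_one hyx))
    · -- `y ≼ x₀` with `x₀` primary of class `𝔮`: `y` has class `𝔮`, so `𝔮' = 𝔮`
      have hy𝔮 : y ∈ 𝔮.carrier := 𝔮.mem_carrier_of_precsim hx hy.1.1 (Precsim.of_dvd hyx)
      exact e (hy.2.symm.trans hy𝔮.2)

/-! ### Finitely supported elements of `M^pf_factor` are factorizations -/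

/-- **Every finitely supported element of `∏_𝔮 M^pf_𝔮` is the factorization of an element of `M^pf`** —
from clauses (a)(b)(c) alone (induction on the support: peel off one `𝔮`-component, which is the
factorization of the corresponding element of `M^pf_𝔮`). [cite: MochizukiFrdI2008, Def. 2.4(i) p.47] -/
theorem mem_range_of_supp_finite (x : PfFactor M) (hx : (supp (pfFactorToRlfFactor M x)).Finite) :
    pfFactorToRlfFactor M x ∈ Set.range (factorMap M) := by
  classical
  suffices key : ∀ (s : Finset (Primes (Perfection M))) (x : PfFactor M),
      supp (pfFactorToRlfFactor M x) ⊆ ↑s → pfFactorToRlfFactor M x ∈ Set.range (factorMap M) from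
    key hx.toFinset x (by rw [Set.Finite.coe_toFinset])
  intro s
  induction s using Finset.induction_on with
  | empty =>
    intro x hx
    refine ⟨1, ?_⟩
    rw [h.factorMap_one]
    funext 𝔮
    by_contra hne
    exact absurd (hx (show 𝔮 ∈ supp (pfFactorToRlfFactor M x) from fun e => hne e.symm)) (by simp)
  | insert 𝔮 s h𝔮s ih =>
    intro x hx
    -- split off the `𝔮`-component: `x = e_𝔮(x 𝔮) · x'` with `x'` trivial at `𝔮`
    have hsplit : x = Pi.mulSingle 𝔮 (x 𝔮) * Function.update x 𝔮 1 := by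
      funext 𝔮'
      by_cases e : 𝔮' = 𝔮
      · subst e; simp
      · simp [e]
    have hx' : supp (pfFactorToRlfFactor M (Function.update x 𝔮 1)) ⊆ ↑s := by
      intro 𝔮' h𝔮'
      have hne : 𝔮' ≠ 𝔮 := by
        rintro rfl
        exact h𝔮' (by simp [pfFactorToRlfFactor_apply])
      have hmem : 𝔮' ∈ supp (pfFactorToRlfFactor M x) := by
        simpa [supp, pfFactorToRlfFactor_apply, hne] using h𝔮'
      have := hx hmem
      rw [Finset.coe_insert, Set.mem_insert_iff] at this
      exact this.resolve_left hne
    obtain ⟨c', hc'⟩ := ih _ hx'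
    refine ⟨(x 𝔮 : Perfection M) * c', ?_⟩
    rw [h.factorMap_mul, hc', h.factorMap_coe_pfAt 𝔮 (x 𝔮), ← map_mul, ← hsplit]

/-- **A weakly perf-factorial monoid whose factorizations are finitely supported is perf-factorial** (as
printed, clause (d) included). [cite: MochizukiFrdI2008, Def. 2.4(i) p.47] -/
theorem isPerfFactorial_of_supp_finite (hfin : ∀ b : Perfection M, (supp (factorMap M b)).Finite) :
    IsPerfFactorial M where
  isDivisorial := h.isDivisorial
  isMonoprime := h.isMonoprime
  bounded := h.bounded
  factorMap_one := h.factorMap_one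
  factorMap_mul := h.factorMap_mul
  factorMap_injective := h.factorMap_injective
  factorMap_mem_range := h.factorMap_mem_range
  mem_range_of_supp_subset x b hxb := h.mem_range_of_supp_finite x ((hfin b).subset hxb)

end IsPerfFactorialWeak

/-- **On monoids with finitely supported factorizations the printed and the repaired notion coincide.**
[cite: MochizukiFrdI2008, Def. 2.4(i) p.47] -/
theorem isPerfFactorial_iff_weak_of_supp_finite {M : Type u} [CommMonoid M]
    (hfin : ∀ b : Perfection M, (supp (factorMap M b)).Finite) :
    IsPerfFactorial M ↔ IsPerfFactorialWeak M :=
  ⟨IsPerfFactorial.weak, fun h => h.isPerfFactorial_of_supp_finite hfin⟩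

end Literature.AlgebraicGeometry.Frobenioids
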